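import Summits.BirchSwinnertonDyer.BirchSwinnertonDyer.Theorems.ErratumRoadFiveJetchevAtPPerLevel
import Summits.BirchSwinnertonDyer.BirchSwinnertonDyer.Theorems.ErratumRoadFiveJetchevAtPSupply
import Summits.BirchSwinnertonDyer.BirchSwinnertonDyer.Theorems.ClassRecordThreeEulerHalvesAtThreeWalkSupplyAtThreeDisplayPrint
import HarnessLib

/-!
# PORT 3 ↦ p, layer 2b (crux `EulerHalfNotRamNoInertSetAtFive`, item stmt-BirchSwinnertonDyer-19715, deciding stub `stub_jetchevAtP`; RULING 52):
# TARGET (A) AT A GENERAL ODD PRIME — «Jetchev's global divisibility with the carrier at the multiplicative BSD prime itself»,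
# `jetchevMaxHLAtP_of_facts_of_print`, from SIX PRINTED NAMED FACTS

Cell `bsd-stepL`, seat `bsd-line-er5-p1-w2` (D-0154 width seat -w2; lead `bsd-line-er5-p1`), `--supports stmt-BirchSwinnertonDyer-19715`
(helper). THEOREMS ONLY, Theses-free (r3), namespace `…X11b.AtP.Koly` (P3). The p = 3 originals (NOT edited):
`Three.Koly.jetchevMaxHLAtThree_of_facts_of_perLevel` (`…JetchevMaxOfFacts.lean`) and tam3-p1 g8's
`Three.Koly.jetchevMaxHLAtThree_of_facts_of_print` (`…WalkSupplyAtThreeDisplayPrint.lean`, p547155). PORT RULE (P2): `3 ↦ (p : ℕ) [Fact p.Prime]`,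
weakest side condition `p ≠ 2`; the frame carries the explicit binder `NumberField.discr K ≠ -3` (P1 certificate: the only non-parametric step of the
originals); the rest is the original text (audit by diff).

* `jetchevMaxHLAtP_of_facts_of_perLevel` — {McCallum Prop. 5.2, Darmon Thm. 3.6 datum, Shimura reciprocity at conductor 1, Gross–Zagier, modularity}
  + the per-level inequality ⟹ HL at p.
  -- adapted from Summits/BirchSwinnertonDyer/BirchSwinnertonDyer/Theorems/ClassRecordThreeEulerHalvesAtThreeJetchevMaxOfFacts.lean
* **`jetchevMaxHLAtP_of_facts_of_print`** — TARGET (A): h52 McCallum Prop. 5.2 · h44 McCallum Prop. 4.4 · hGZ Gross–Zagier · hmod modularity ·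
  hPT Poitou–Tate for Selmer structures · hF1 `Gross1991_heegnerPoint_sub_ratTorsion_mem_E0` ⟹ for every globally minimal `W/ℚ` with `r_an = 1`,
  `Mult W p`, `Surj W p` (`p` odd), every Manin-good conductor-1 Heegner frame (`K`, `Dt`, `β`, `ι`; `Odd d_K`, `d_K ≠ −3`, `L(E^{d_K},1) ≠ 0`,
  `p ∤ Dt.c`), EVERY finite place `v` and every `s ≤ ord_p c_v(E)` — `v = (p)` NOT excluded —, every squarefree Kolyvagin level `n` of index `≥ s`:
  `PDiv d p s` (the derived Heegner classes are `p^s`-divisible). This is the p-GENERIC form of Jetchev 2008 Thm. 1.4 («m_∞ ≥ max_q ord_p c_q») in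
  McCallum's currency, the carrier allowed to be the multiplicative BSD prime itself — the content of `stub_jetchevAtP` up to McCallum's upper half.
  -- adapted from Summits/BirchSwinnertonDyer/BirchSwinnertonDyer/Theorems/ClassRecordThreeEulerHalvesAtThreeWalkSupplyAtThreeDisplayPrint.lean

HONEST FRAMING: CONDITIONAL on the six displayed named facts taken as hypotheses (h52∕h44 carry McCallum's tower-surjectivity binder — supplied here
by the generic tower lemma — and the flag Kolyvagin1991-LNM1479-primary-unread, r2; hPT typed-not-proved); NO schema, NO `sorry`, NO new named fact;
nothing booked; no census label moves (T7); `stub_jetchevAtP` is NOT yet closed (layer 3: + McCallum's upper half + the Ш-index bookkeeping);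
BSD is proved for no curve.
[cite: McCallumLMS1991, §4 Prop. 4.4, §5 Prop. 5.2] [cite: Jetchev2008, Thm. 1.4 (p. 812)] [cite: GrossLMS1991, §6, Prop. 5.3] [cite: MilneADT2006, Ch. I, Thm. 4.10(b)]
-/

set_option autoImplicit false

noncomputable section

open scoped Classical NumberField

namespace Summit.BirchSwinnertonDyer.Rank1Residual.X11b.AtP.Koly

open WeierstrassCurve IsDedekindDomain NumberField Field Literature.NumberTheory.EllipticCurves
  Literature.NumberTheory.EllipticCurves.ModularForms Literature.NumberTheory.EllipticCurves.Jetchev2008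
  Literature.NumberTheory.EllipticCurves.KolyvaginCocycle
  Literature.NumberTheory.EllipticCurves.Rank1Residual Literature.NumberTheory.GaloisRepresentations
  Literature.NumberTheory.GaloisRepresentations.DiscreteGaloisModule
  Literature.NumberTheory.GaloisCohomology Literature.NumberTheory.Automorphic
  Summit.BirchSwinnertonDyer.Rank1Residual.X11b Summit.BirchSwinnertonDyer.Rank1Residual.JET
  Summit.BirchSwinnertonDyer.Rank1Residual.X11b.Three.Koly

/-- **`stub_jetchevMaxHLAtP` VERBATIM from five named print facts and the per-level inequality.**
Facts (all `def … : Prop` in `Literature`, used BY NAME as hypotheses — the theorem is CONDITIONAL on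
them): McCallum 1991 Prop. 5.2 (`h52`, typed by `bsd-jet-lit-ty`), Darmon 2004 Thm. p.6 (`hD36`),
Shimura reciprocity at conductor 1 (`hrec`) — the last two are conjuncts of skeleton v4's
`stub_kolyFactsAtP` —, Gross–Zagier (`hGZ`) and modularity (`hmod`) — conjuncts 1 and 7 of item
19112 `PublishedInputsThree`. The sixth hypothesis `hlev` is the per-level inequality
`ord₃ c_v ≤ m(n)` (`m(n) < k`, `ord₃ c_v ≤ k`, `k + m(n) ≤ M(n)`) = the conclusion of
`JET.Section6.tamagawaExponent_le_m_of_selmerFamilies` (p484791) once its level-`p^k` Selmer families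
are INSTANTIATED on `H¹(K, E[p^k])` at the admissible conductors of the frame — NOT in the tree. So
the tree now shows: `stub_jetchevMaxHLAtP ⟸ {5 print facts} + {instantiation of the kernel §6}`;
Jetchev 2008 35–6 contribute no further input. Nothing is discharged unconditionally; the stub
stays open; no item closes; 0 classes move (T7). [cite: Jetchev2008, Thm. 1.4 (p. 812), Proof of
Thm. 1.4 (p. 825)] [cite: McCallumLMS1991, §5 Prop. 5.2 (p. 304)] [cite: Darmon2004, Thm. p.6]
[cite: GrossZagier1986, Thm. I.(6.3)] -/
theorem jetchevMaxHLAtP_of_facts_of_perLevel (p : ℕ) [Fact p.Prime] (hp2 : p ≠ 2)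
    (h52 : McCallum1991.prop52_exists_conductor_kolyvaginClass_order_eq)
    (hD36 : ∀ (N : ℕ) [NeZero N] (W : WeierstrassCurve ℚ) (K : Type) [Field K] [NumberField K],
      phi_heegnerTau_mem_singularModuliField N W K)
    (hrec : ∀ (N : ℕ) [NeZero N] (W : WeierstrassCurve ℚ) (K : Type) [Field K] [NumberField K],
      heegnerPointOfConductor_one_galoisConj N W K)
    (hGZ : ∀ (N : ℕ) [NeZero N] (W : WeierstrassCurve ℚ) (K : Type) [Field K] [NumberField K],
      gross_zagier N W K)
    (hmod : hasEntireLFunction_rat)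
    (hlev : ∀ (W : WeierstrassCurve ℚ) [W.IsElliptic] [W.IsGloballyMinimal] [NeZero (W.conductorNorm ℤ)]
      (K : Type) [Field K] [NumberField K]
      (Dt : ModularParametrizationData W (W.conductorNorm ℤ)) (β : ℤ) (ι : K →+* ℂ),
      W.analyticRank = 1 → W.HasMultiplicativeReductionAtPrime p → Surj W p →
      IsImaginaryQuadratic K → SatisfiesHeegnerHypothesis (W.conductorNorm ℤ) K →
      Odd (NumberField.discr K) → NumberField.discr K ≠ -3 → (W.quadraticTwist (NumberField.discr K : ℚ)).entireLFunction 1 ≠ 0 →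
      (4 * (W.conductorNorm ℤ : ℤ)) ∣ β ^ 2 - NumberField.discr K → ¬ (p : ℤ) ∣ Dt.c →
      ∀ (v : HeightOneSpectrum (𝓞 ℚ)) (k n : ℕ) (d : KolyvaginHeegnerData Dt β ι n), Squarefree n →
        (∀ ℓ ∈ n.primeFactors, Zhang2014.IsKolyvaginPrime (W.conductorNorm ℤ) W K p ℓ) →
        (if divOrd d p < Zhang2014.levelIndex W p n then divOrd d p else (⊤ : ℕ∞)) < (k : ℕ∞) →
        padicValNat p (W.tamagawaNumberAt v) ≤ k →
        (k : ℕ∞) + (if divOrd d p < Zhang2014.levelIndex W p n then divOrd d p else ⊤) ≤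
          Zhang2014.levelIndex W p n →
        (padicValNat p (W.tamagawaNumberAt v) : ℕ∞) ≤
          (if divOrd d p < Zhang2014.levelIndex W p n then divOrd d p else ⊤)) :
    ∀ (W : WeierstrassCurve ℚ) [W.IsElliptic] [W.IsGloballyMinimal] [NeZero (W.conductorNorm ℤ)]
      (K : Type) [Field K] [NumberField K]
      (Dt : ModularParametrizationData W (W.conductorNorm ℤ)) (β : ℤ) (ι : K →+* ℂ),
      W.analyticRank = 1 → W.HasMultiplicativeReductionAtPrime p → Surj W p →
      IsImaginaryQuadratic K → SatisfiesHeegnerHypothesis (W.conductorNorm ℤ) K →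
      Odd (NumberField.discr K) → NumberField.discr K ≠ -3 → (W.quadraticTwist (NumberField.discr K : ℚ)).entireLFunction 1 ≠ 0 →
      (4 * (W.conductorNorm ℤ : ℤ)) ∣ β ^ 2 - NumberField.discr K → ¬ (p : ℤ) ∣ Dt.c →
      ∀ (v : HeightOneSpectrum (𝓞 ℚ)) (s : ℕ), s ≤ padicValNat p (W.tamagawaNumberAt v) →
        ∀ (n : ℕ) (d : KolyvaginHeegnerData Dt β ι n), Squarefree n →
          (∀ ℓ ∈ n.primeFactors, Zhang2014.IsKolyvaginPrime (W.conductorNorm ℤ) W K p ℓ ∧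
            s ≤ Zhang2014.kolyvaginIndex W p ℓ) → PDiv d p s :=
  jetchevMaxHLAtP_of_prop52_of_perLevel p hp2 h52
    (fun W _ _ _ K _ _ Dt β ι hr _ _ hK hHN _ _ hLt hβ _ =>
      exists_kolyvaginHeegnerData_one_not_isOfFinAddOrder W K (hD36 _ W K) (hrec _ W K) (hGZ _ W K)
        hmod Dt β ι hr hK hHN hLt hβ)
    hlev

/-- **`stub_jetchevMaxHLAtP` VERBATIM modulo SIX named Literature facts** (McCallum Prop. 5.2 and
Prop. 4.4, Gross–Zagier, modularity, Poitou–Tate for Selmer structures, Gross 1991 §6 ∕ [GZ86 III (p.1)]);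
CONDITIONAL, nothing asserted about any curve; see the module docstring.
[cite: Jetchev2008, Thm. 1.4 (p. 812), Proof of Thm. 1.4 (p. 825)] [cite: McCallumLMS1991, §4 Prop. 4.4,
§5 Prop. 5.2] [cite: GrossLMS1991, §5 Prop. 5.3, §6 Prop. 6.2 (1)] [cite: GrossZagier1986, III (p.1)] -/
theorem jetchevMaxHLAtP_of_facts_of_print (p : ℕ) [Fact p.Prime] (hp2 : p ≠ 2)
    -- NAMED LITERATURE FACTS (cite-only)
    (h52 : McCallum1991.prop52_exists_conductor_kolyvaginClass_order_eq)
    (h44 : McCallum1991.prop44_localOrder_kolyvaginClass_mul_eq)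
    (hGZ : ∀ (N : ℕ) [NeZero N] (W : WeierstrassCurve ℚ) (K : Type) [Field K] [NumberField K],
      gross_zagier N W K)
    (hmod : hasEntireLFunction_rat)
    (hPT : ∀ (K : Type) [Field K] [NumberField K], poitouTate_selmerStructure_duality_conj K)
    (hF1 : Gross1991_heegnerPoint_sub_ratTorsion_mem_E0) :
    ∀ (W : WeierstrassCurve ℚ) [W.IsElliptic] [W.IsGloballyMinimal] [NeZero (W.conductorNorm ℤ)]
      (K : Type) [Field K] [NumberField K]
      (Dt : ModularParametrizationData W (W.conductorNorm ℤ)) (β : ℤ) (ι : K →+* ℂ),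
      W.analyticRank = 1 → W.HasMultiplicativeReductionAtPrime p → Surj W p →
      IsImaginaryQuadratic K → SatisfiesHeegnerHypothesis (W.conductorNorm ℤ) K →
      Odd (NumberField.discr K) → NumberField.discr K ≠ -3 → (W.quadraticTwist (NumberField.discr K : ℚ)).entireLFunction 1 ≠ 0 →
      (4 * (W.conductorNorm ℤ : ℤ)) ∣ β ^ 2 - NumberField.discr K → ¬ (p : ℤ) ∣ Dt.c →
      ∀ (v : HeightOneSpectrum (𝓞 ℚ)) (s : ℕ), s ≤ padicValNat p (W.tamagawaNumberAt v) →
        ∀ (n : ℕ) (d : KolyvaginHeegnerData Dt β ι n), Squarefree n →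
          (∀ ℓ ∈ n.primeFactors, Zhang2014.IsKolyvaginPrime (W.conductorNorm ℤ) W K p ℓ ∧
            s ≤ Zhang2014.kolyvaginIndex W p ℓ) → PDiv d p s := by
  refine jetchevMaxHLAtP_of_facts_of_perLevel p hp2 h52
    (fun N _ W K _ _ ↦ phi_heegnerTau_mem_singularModuliField_holds N W K)
    (fun N _ W K _ _ ↦ heegnerPointOfConductor_one_galoisConj_holds N W K) hGZ hmod ?_
  intro W _ _ _ K _ _ Dt β ι hr hmult hρ hK hHN hodd hD3 hLt hβ hc3 v k n d hsq hkol h1 h2 h3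
  -- `k ≥ 1` and the admissibility of `n` at level `k`
  have hk : 1 ≤ k := by
    rcases Nat.eq_zero_or_pos k with rfl | hk
    · exact absurd h1 (by simp)
    · exact hk
  have hkM : (k : ℕ∞) ≤ Zhang2014.levelIndex W p n := le_trans le_self_add h3
  have hn : Squarefree n ∧ ∀ q ∈ n.primeFactors,
      Zhang2014.IsKolyvaginPrime (W.conductorNorm ℤ) W K p q ∧ k ≤ Zhang2014.kolyvaginIndex W p q :=
    ⟨hsq, fun q hq ↦ ⟨hkol q hq, Zhang2014.natCast_le_levelIndex_iff.mp hkM q hq⟩⟩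
  -- frame facts: complex conjugation, `(N, d_K) = 1`, `d_K < -4`
  obtain ⟨τ, hτ⟩ := exists_algEquiv_ne_one_of_isImaginaryQuadratic K hK
  have hND : IsCoprime ((W.conductorNorm ℤ : ℕ) : ℤ) (NumberField.discr K) :=
    KolyvaginAssembly.isCoprime_discr_of_satisfiesHeegnerHypothesis hK hHN
  have hD : NumberField.discr K < -4 := by
    have hneg : NumberField.discr K < 0 := hK.discr_neg
    have h4 : NumberField.discr K % 4 = 0 ∨ NumberField.discr K % 4 = 1 :=
      Literature.NumberTheory.QuadraticFields.Quadratic.discr_emod_four (K := K) hK.1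
    obtain ⟨r, hr⟩ := hodd
    omega
  -- Gross's one system of choices extending `d`, and Prop. 4.7 for it (from `h44`)
  have hcm : ¬ W.HasCM := not_hasCM_of_hasMultiplicativeReductionAtPrime' W hmult
  have htower : ∀ j : ℕ, W.HasSurjectiveModNGaloisRep (p ^ j : ℕ) :=
    forall_hasSurjectiveModNGaloisRep_pow_of_multiplicative_of_surj W p hp2 hmult hρ
  obtain ⟨D, hDd, h47⟩ := exists_data_h47Base_of_prop44 h44 W hcm hK hD hHN (p := p) hp2 htower
    Dt β ι hk hn d
  -- the sign `ε := −w(E)`, a sign function for it, and Gross Prop. 5.3 for the data — UNCONDITIONAL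
  -- (bsd-jet reader 1's `JET.exists_mem_ringClassGal_isOfFinAddOrder_conj_sub_smul`: Shimura reciprocity
  -- at conductor `m` + x11b3's `KolyvaginA53.h53_of_recM`; admissible conductors are `≠ 0`, prime to `N`)
  have hε : (-W.rootNumber : ℤ) = 1 ∨ (-W.rootNumber : ℤ) = -1 := by
    rcases W.rootNumber_eq_one_or with h | h <;> simp [h]
  obtain ⟨eb, heb, hebε⟩ := Walk.exists_signFunction (-W.rootNumber) hε
  have h53D : ∀ (s s' : {m : ℕ // Squarefree m ∧ ∀ q ∈ m.primeFactors,
        Zhang2014.IsKolyvaginPrime (W.conductorNorm ℤ) W K p q ∧ k ≤ Zhang2014.kolyvaginIndex W p q})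
      (_ : s'.1 ∣ s.1) (τm : ringClassField K ι s'.1 ≃ₐ[ℚ] ringClassField K ι s'.1),
      (∀ x : ringClassField K ι s'.1, ((τm x : ringClassField K ι s'.1) : ℂ) = starRingEnd ℂ x) →
      ∃ σ' ∈ ringClassGal ι s'.1, IsOfFinAddOrder
        (pointGalHom W (ringClassField K ι s'.1) τm (D s').y -
          (-W.rootNumber) • pointGalHom W (ringClassField K ι s'.1) σ' (D s').y) := by
    intro s s' _ τm hτm
    obtain ⟨hm0, hmN⟩ := ne_zero_and_coprime_of_isKolyvaginPrime (K := K) s'.2.1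
      (fun q hq ↦ (s'.2.2 q hq).1)
    exact exists_mem_ringClassGal_isOfFinAddOrder_conj_sub_smul W hK hHN Dt ι hm0 hmN (D s') τm hτm
  -- the supply at this frame, for these data and signs
  obtain ⟨𝒯, 𝒮, Qcar, C', hS, hQcar, hdisj, hPT, hselmer, hC, hdual_q, hsel0, hdual_ℓ⟩ :=
    selmerSupplyAtP_of_poitouTate_Gross1991 p hp2 hPT hF1 W K Dt β ι hr hmult hρ hK hHN hodd hD3 hLt hβ hc3 τ hτ
      v k hk h2 n d hn D hDd (-W.rootNumber) hε eb heb hebε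
  have h49 := h49_of_selmerMembership W hK hND hD (p := p) hp2 hρ Dt β ι hτ hk 𝒯 𝒮 Qcar D eb
    (-W.rootNumber) hebε h53D n hsel0
  have hordκ := hordκ_of_admissibleData W hK hND hD (p := p) hp2 hρ Dt β ι k D
  have hdivfin := fun s ↦ divOrd_ne_top_of_levelIndex_eq_top p W K
    (heegnerPointOfConductor_one_galoisConj_holds _ W K) (hGZ _ W K) hmod Dt β ι hr hK hHN hLt s (D s)
  have hfin := JET.Walk.hfin_of_kummer (K := K) W (Fact.out : p.Prime) k 𝒯
  have hκt := hκt_of_selmerMembership W hK hND hD (p := p) hp2 hρ Dt β ι hτ hk 𝒯 D eb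
    (-W.rootNumber) hebε h53D hdivfin hselmer
  have key := tamagawaExponent_le_m_of_orderedFamiliesBase W K hK p hp2 hρ Dt β ι τ hτ k
    (padicValNat p (W.tamagawaNumberAt v)) hk h2 𝒯 𝒮 hS Qcar hQcar D eb heb n hn ?_ ?_ hdisj hfin hPT
    (fun s _ ↦ hκt s) hordκ h47 C' hC hdual_q h49 hdual_ℓ
  · rw [hDd] at key
    exact key
  · rw [hDd]; exact h1
  · rw [hDd]; exact h3

end Summit.BirchSwinnertonDyer.Rank1Residual.X11b.AtP.Koly

end
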